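import Mathlib
import Summits.QuantumFields.QCD.Theses.NestedDissectionSea

/-!
# Sketch — crux-ideate stmt-QuantumFields-13995 (`EarlyCrosserLaw`), round 1, ideator 2

First-lemma signatures for the three idea cards (need not be proved; must elaborate):
* `KacRiceCrossingBound`   (card `kac-rice-hermitian-dos`)
* `JensenDiscCount`, `KyFanEarlyCount` (card `jensen-disc-count`)
* `AccretiveSchurTransfer` (card `accretive-feshbach-coarse-sign`)
-/

noncomputable section

open scoped BigOperators Matrix ComplexConjugate
open Filter MeasureTheory
open Literature.MathematicalPhysics.QuantumLattice Literature.MathematicalPhysics.QuantumFieldTheory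
  Literature.Probability.LatticeModels

namespace Summit.QuantumFields.QCD.Cruxes.EarlyCrosserLaw.Ideator2

open Classical

/-- Local notation: the colour group `SU(3)`. -/
local notation "𝔾" => Matrix.specialUnitaryGroup (Fin 3) ℂ

variable {N : ℕ} [NeZero N]

/-- The Hermitian Wilson cell operator `H_c(μ) = Γ₅ · wilsonCell U μ 0 s` (Γ₅ = diag(1,1,-1,-1) on the
spin index, site/colour diagonal, so left multiplication rescales rows). -/
def hermCell (U : GaugeConfig 4 N 𝔾) (μ : ℝ) (s : Fin 4 → ℕ) :
    Matrix {p // wilsonBox (0 : TorusSite 4 N) s p} {p // wilsonBox (0 : TorusSite 4 N) s p} ℂ :=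
  Matrix.of fun p q => gammaFive p.1.2.2 p.1.2.2 * wilsonCell U μ 0 s p q

/-- Number of CROSSING MASSES of the corner-0 cell in `[α, β]`, with multiplicity: real roots `λ` of the
characteristic polynomial of the massless cell operator with `-λ ∈ [α, β]`
(`det (wilsonCell U μ' 0 s) = 0 ↔ -μ'` is an eigenvalue of `wilsonCell U 0 0 s`). -/
def crossingCount (U : GaugeConfig 4 N 𝔾) (s : Fin 4 → ℕ) (α β : ℝ) : ℕ :=
  Multiset.card
    ((wilsonCell U 0 0 s).charpoly.roots.filter (fun z : ℂ => z.im = 0 ∧ α ≤ -z.re ∧ -z.re ≤ β))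

/-- **Card `kac-rice-hermitian-dos`, first lemma (Kac–Rice crossing bound).** The eigenvalue branches of
the Hermitian affine pencil `μ ↦ H_c(μ) = H_c(0) + μ Γ₅` are 1-Lipschitz (`‖Γ₅‖ = 1`; slope = minus the
chirality `⟨ψ, Γ₅ ψ⟩ ∈ [-1, 1]`), so the number of crossing masses in `[α, β]` (with multiplicity) is at
most `liminf_{η → 0⁺} (2η)⁻¹ ∫_α^β #{i : |λ_i(H_c(μ))| < η} dμ`; taking expectations turns the
early-crosser count into the bare-mass integral of the mean density of states of `H_c(μ)` at zero. -/
def KacRiceCrossingBound : Prop :=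
  ∀ (N : ℕ) [NeZero N] (U : GaugeConfig 4 N 𝔾) (s : Fin 4 → ℕ) (α β : ℝ), α ≤ β →
    ∀ hH : ∀ μ : ℝ, (hermCell U μ s).IsHermitian,
      (crossingCount U s α β : ℝ) ≤
        Filter.liminf (fun η : ℝ => (1 / (2 * η)) *
            ∫ μ in Set.Icc α β, (Fintype.card {i // |(hH μ).eigenvalues i| < η} : ℝ))
          (nhdsWithin (0 : ℝ) (Set.Ioi 0))

/-- **Card `jensen-disc-count`, first lemma (Jensen disc count).** For the characteristic polynomial
`p` of the massless cell operator and a centre `-c` on the real axis with `p(-c) ≠ 0`, the number of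
crossing masses in `[c - R/2, c + R/2]` (indeed of ALL roots in the closed disc of radius `R/2` about
`-c`) times `log 2` is at most the excess of the circle average of `log |p|` on `|z + c| = R` over its
centre value (Jensen's formula; cf. `Literature.Analysis.Complex.sum_divisor_le_of_circleAverage_le`). -/
def JensenDiscCount : Prop :=
  ∀ (N : ℕ) [NeZero N] (U : GaugeConfig 4 N 𝔾) (s : Fin 4 → ℕ) (c R : ℝ), 0 < R →
    ((wilsonCell U 0 0 s).charpoly.eval (-(c : ℂ)) ≠ 0) →
      (crossingCount U s (c - R / 2) (c + R / 2) : ℝ) * Real.log 2 ≤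
        Real.circleAverage (fun z : ℂ => Real.log ‖(wilsonCell U 0 0 s).charpoly.eval z‖) (-(c : ℂ)) R
          - Real.log ‖(wilsonCell U 0 0 s).charpoly.eval (-(c : ℂ))‖

/-- **Card `jensen-disc-count`, support (Ky Fan early count).** Real parts of the eigenvalues of the
massless cell operator `M` are majorised by the eigenvalues of its Hermitian part `W = (M + Mᴴ)/2`
(Ky Fan), hence for `c' < c`: `#{λ ∈ spec M : Re λ < c'} · (c - c') ≤ c · #{w ∈ spec W : w < c}` —
deterministically few eigenvalues (complex ones included) can sit left of the valence point. -/
def KyFanEarlyCount : Prop :=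
  ∀ (N : ℕ) [NeZero N] (U : GaugeConfig 4 N 𝔾) (s : Fin 4 → ℕ) (c c' : ℝ), c' < c → 0 < c →
    (Multiset.card ((wilsonCell U 0 0 s).charpoly.roots.filter (fun z : ℂ => z.re < c')) : ℝ)
        * (c - c') ≤
      c * (Fintype.card
        {i // (Matrix.isHermitian_add_transpose_self (wilsonCell U 0 0 s)).eigenvalues i < 2 * c} : ℝ)

/-- **Card `accretive-feshbach-coarse-sign`, first lemma (accretive Schur transfer).** Abstract form,
to be applied in an eigenbasis of the Hermitian part `W` of the massless cell operator adapted to `Γ₅`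
(`W` is spin-trivial, so such a basis exists; `q` = the `W < c` block): if `M` is `Γ`-Hermitian for an
involution `Γ` that respects the split and the complementary (`¬ q`) compression of `M` is accretive
with margin `θ > 0`, then that compression has REAL POSITIVE determinant and
`det M = det M_{¬q¬q} · det (Schur complement onto q)`: every zero and the sign of `det M` are carried by
the coarse (Feshbach) operator. -/
def AccretiveSchurTransfer : Prop :=
  ∀ (ι : Type) [Fintype ι] [DecidableEq ι] (M Γ : Matrix ι ι ℂ) (q : ι → Prop) [DecidablePred q]
    (θ : ℝ), 0 < θ → Γ * Γ = 1 → Γ.IsHermitian → Γ * M * Γ = Mᴴ →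
    (∀ i j, q i → ¬ q j → Γ i j = 0) →
    (∀ v : ι → ℂ, (∀ i, q i → v i = 0) →
        θ * (∑ i, ‖v i‖ ^ 2) ≤ (star v ⬝ᵥ M.mulVec v).re) →
    let A := M.toBlock q q
    let B := M.toBlock q (fun i => ¬ q i)
    let C := M.toBlock (fun i => ¬ q i) q
    let D := M.toBlock (fun i => ¬ q i) (fun i => ¬ q i)
    IsUnit D.det ∧ 0 < D.det.re ∧ D.det.im = 0 ∧ M.det = D.det * (A - B * D⁻¹ * C).det

end Summit.QuantumFields.QCD.Cruxes.EarlyCrosserLaw.Ideator2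

end
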